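import Mathlib
import Summits.Ventures.PercRepro2.HCov
import Summits.Ventures.PercRepro2.HCovSwap
import Summits.Ventures.PercRepro2.EdgeCubic
import Summits.Ventures.PercRepro2.FirstOrderTerms
import Summits.Ventures.PercRepro2.FirstOrderPendantClass
import Summits.Ventures.PercRepro2.PendantB2Dict
import Summits.Ventures.PercRepro2.PendantDmixThm
import Summits.Ventures.PercRepro2.PendantDegenerate

/-!
# The degree-one-root contraction of (HCOV), unconditional (blind cell PercRepro2, p5 g24;
`proofs/P5-OEDGE.md` §30)

At a pendant root edge `e = {a₂, z}` (the only edge at the root `a₂`), `(HCOV)` at the contraction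
`p[e ↦ 1]` gives `(HCOV)` at the pendant instance `p`, for EVERY weight `p e ∈ [0, 1]` and with NO
non-degeneracy hypothesis (**`HCov_pendant_root_all`**):

* `p e = 1`: the two instances coincide;
* `D = P_{p[e↦1]}(PD) > 0`: then `D₀ ≥ D > 0` and `PendantDmixThm.HCov_pendant_root` applies
  (`B2 = 2·Tcl`, `2·D₀·D·Tcl = 2·Kc + D₀²·Gc`, `Kc ≥ 0`);
* `D = 0`: `B2 = 2·Tcl ≥ 0` by the degenerate corner `PendantDegenerate.Tcl_nonneg_of_D_eq_zero`,
  and `FirstOrderPendantClass.HCov_pendant_root_of_B2` closes.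

The mirror statement at a pendant root `a₁` (**`HCov_pendant_root_all'`**) follows from the root
symmetry `HCov_swap`, and **`HCov_pendant_either_root_all`** states both at once: (HCOV) is closed
under attaching a root of degree one, at every weight of the new edge.
-/

namespace Summit.Ventures.PercRepro2

open UnionCluster

namespace CovForm

namespace FirstOrder

section All

variable {V : Type*} {E : Type*} [Fintype E] [DecidableEq E] [Fintype V] [DecidableEq V]
  {R : Type*} [Field R] [LinearOrder R] [IsStrictOrderedRing R]

omit [Fintype V] [DecidableEq V] in
/-- `D ≤ D₀` (`PD ⊆ {a₁ ↮ a₃}`). -/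
lemma D_le_D0 (p : E → R) (hp : IsProbVec p) (ends : E → Sym2 V) (a₁ a₂ a₃ : V) :
    prob p (PDEvent ends a₁ a₂ a₃) ≤ D0 p ends a₁ a₃ := by
  unfold D0
  refine prob_mono hp fun ω hω => ?_
  rw [mem_PDEvent_iff] at hω
  exact (mem_D0_iff).2 fun hc => hω.2.1 (conn_symm hc)

omit [Fintype E] [Fintype V] [DecidableEq V] [LinearOrder R] [IsStrictOrderedRing R] in
/-- Pinning an edge of weight one changes nothing. -/
lemma update_one_eq_self {p : E → R} {e : E} (he : p e = 1) : Function.update p e 1 = p := by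
  rw [← he]
  exact Function.update_eq_self e p

variable {ends : E → Sym2 V} {p : E → R} {e : E} {a₂ z : V}

/-- **THE DEGREE-ONE-ROOT CONTRACTION OF (HCOV), UNCONDITIONAL**: at a pendant root edge
`e = {a₂, z}`, `(HCOV)` at the contraction gives `(HCOV)` at the pendant instance — every weight of
the edge, no non-degeneracy. -/
theorem HCov_pendant_root_all (hp : IsProbVec p) (hleaf : ∀ f, a₂ ∈ ends f → f = e)
    (hends : ends e = s(a₂, z)) {o a₁ a₃ b : V} (ho : o ≠ a₂) (h1 : a₁ ≠ a₂) (h3 : a₃ ≠ a₂)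
    (hb : b ≠ a₂) (h₁ : HCov (Function.update p e 1) ends o a₁ a₂ a₃ b) :
    HCov p ends o a₁ a₂ a₃ b := by
  by_cases he : p e = 1
  · rwa [update_one_eq_self he] at h₁
  · have hq : IsProbVec (Function.update p e 1) := hp.update e zero_le_one le_rfl
    have hD0 : 0 ≤ prob (Function.update p e 1) (PDEvent ends a₁ a₂ a₃) := prob_nonneg hq _
    rcases eq_or_lt_of_le hD0 with hD | hD
    · -- the degenerate corner `D = 0`: `B2 = 2·Tcl ≥ 0`
      apply HCov_pendant_root_of_B2 hp he hleaf hends ho h1 h3 hb h₁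
      rw [B2_eq_two_Tcl he hleaf hends ho h1 h3 hb]
      have := Tcl_nonneg_of_D_eq_zero (Function.update p e 1) hq ends o a₁ a₂ a₃ b hD.symm
      linarith
    · -- `D > 0`, hence `D₀ ≥ D > 0`: the non-degenerate theorem
      apply HCov_pendant_root hp he hleaf hends ho h1 h3 hb h₁
      exact mul_pos (lt_of_lt_of_le hD (D_le_D0 _ hq ends a₁ a₂ a₃)) hD

/-- **The mirror: a pendant root `a₁`** (edge `e = {a₁, z}`, the only edge at `a₁`), by the root
symmetry `HCov_swap`. -/
theorem HCov_pendant_root_all' (hp : IsProbVec p) {a₁ : V} (hleaf : ∀ f, a₁ ∈ ends f → f = e)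
    (hends : ends e = s(a₁, z)) {o a₃ b : V} (ho : o ≠ a₁) (h2 : a₂ ≠ a₁) (h3 : a₃ ≠ a₁)
    (hb : b ≠ a₁) (h₁ : HCov (Function.update p e 1) ends o a₁ a₂ a₃ b) :
    HCov p ends o a₁ a₂ a₃ b :=
  (HCov_swap p ends o a₁ a₂ a₃ b).1
    (HCov_pendant_root_all hp hleaf hends ho h2 h3 hb
      ((HCov_swap (Function.update p e 1) ends o a₁ a₂ a₃ b).2 h₁))

/-- **(HCOV) is closed under attaching a root of degree one**: for a leaf root (`a₂` or `a₁`) with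
its only edge `e`, `(HCOV)` at the contraction `p[e ↦ 1]` gives `(HCOV)` at `p`, every weight. -/
theorem HCov_pendant_either_root_all (hp : IsProbVec p) {o a₁ a₃ b : V}
    (h : (ends e = s(a₂, z) ∧ (∀ f, a₂ ∈ ends f → f = e) ∧ o ≠ a₂ ∧ a₁ ≠ a₂ ∧ a₃ ≠ a₂ ∧ b ≠ a₂) ∨
      (ends e = s(a₁, z) ∧ (∀ f, a₁ ∈ ends f → f = e) ∧ o ≠ a₁ ∧ a₂ ≠ a₁ ∧ a₃ ≠ a₁ ∧ b ≠ a₁))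
    (h₁ : HCov (Function.update p e 1) ends o a₁ a₂ a₃ b) :
    HCov p ends o a₁ a₂ a₃ b := by
  rcases h with ⟨hends, hleaf, ho, h1, h3, hb⟩ | ⟨hends, hleaf, ho, h2, h3, hb⟩
  · exact HCov_pendant_root_all hp hleaf hends ho h1 h3 hb h₁
  · exact HCov_pendant_root_all' hp hleaf hends ho h2 h3 hb h₁

end All

end FirstOrder

end CovForm

end Summit.Ventures.PercRepro2
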